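import Summits.NavierStokesRegularity.NavierStokesRegularity.Theorems.ScenarioCensusRowD9
import HarnessLib

/-!
# Census row F4b′ in the Leray–Hopf frame (`Row_F4bpLH`) ⟺ its WILD residual — the decls of ns-idea-9 LINE 15
# «rate_gate» that are not already in the tree through LINE 16's port, BY NAME

Re-homed for the scenario census (typer seat ns-census-typer-1 g7; companion of the nine-part port `ScenarioCensusRowD9*.lean` of
LINE 16 «modulation_gate» rev 5 1d7b2cd493e504e0): PORT of ns-idea-9 LINE 15 «rate_gate» rev 4.1,
`pub/ideators/ns-idea-9/lines/rate_gate/rate_gate.lean` sha16 06ceb4a13f67c0fe (1564 l., lean check rc 0, 0 sorry, 0 warnings;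
critic idea-crit-8 V64/V69/V70 PASS; ref ns-census-ref g8 PRE-CHECK ✓ §13.14 [3/6]–[4/6] of rev 4 7a571db8b9f57705 = 4.1 modulo lint;
TARGET-MENU r4 names this line as row F4b′'s lever; CENSUS-FINAL r6 §2 edge `row_F4bpLH_of_row_D9LH` is TREE since the LINE 16 port).
LINE 15 and LINE 16 share most of their text BYTE-VERBATIM (the CORE `SteadyZoomDistance` + `CoreProof`, the generic dissipation
lemmas, the rung, `Row_F4bpLH`, `RateGate`, `typeIIScale` / `typeIIField` / `typeIIRemainder` / `rateGateQuantity`,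
`Row_F4bSharp`, …): those are taken from the tree's `…ScenarioCensus.ModulationGate` BY NAME and are NOT re-declared.  Declared
here (namespace `…Theorems.ScenarioCensus.RateGate`, the line's `…Cruxes.Row_F4bp.RateGate` re-homed), statements VERBATIM:
`chaeTypeIIDeviation_eq_remainder`, G1 `DissipationGate`, the wild residual `Row_F4bpLHWild` (`@[conjecture]` added), the kernel
`two_le_of_nineHalves_lt` / `row_F4bpLH_of_gates` / `row_F4bpLHWild_of_row_F4bpLH` / `row_F4bpLH_iff_wild` / `row_F4bpLH_of_steady` /
`row_F4bpLHWild_of_steady`, `chaeModulation_tendsto_atTop`, `dissipationGate_holds'`, the theorem of the line `row_F4bpLH_iff_wild'`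
(UNCONDITIONAL), `row_F4b_of_sharp`, `rateGate_of_le_nineHalves`.  Taken BY NAME because an alias theorem of an already-landed declaration is
refused by the gate lint `dedup.landed`: `rateGate_holds` = `ModulationGate.rateGate'`, `row_F4bSharp_holds` = `ModulationGate.row_F4bSharp_holds'`,
`row_F4b_holds'` = `ModulationGate.row_F4b_holds''` (their two uses renamed — proof-only diffs).  PROOF-ONLY DIFF: `dissipationGate_holds'` is DERIVED from the
tree's modulated gate `ModulationGate.modulatedDissipationGate_holds'` (LINE 16 G1) + `isStationaryModulation_chae` +
`modulatedDeviation_chae` + the tree-only helper `lintegral_chaeModulation_eq_top` (`∫_{(T−ε,T)} (T−t)^{−γ/2} = ∞` for `γ ≥ 2`)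
instead of re-running the line's own 130-line `DissipationProof.integral_test_eq_zero` (whose generic lemmas are LINE 16's).  The
line's two `@[deprecated] stub_*` aliases are not re-declared.  Census KEYS at the end (ns `…ScenarioCensus`): `Row_F4bpLH :=
ModulationGate.Row_F4bpLH` (`@[conjecture]`, rfl alias) and `row_F4bpLH_iff_row_F4bpLHWild`.

No census value is asserted here (row F4b′ stays OPEN-WITH… as booked; by theorem it IS its wild window in the LH frame); NS
regularity is NOT proved; no summit statement is proved by this file.
-/

-- the summit and its single problem share the name `NavierStokesRegularity` (D-0017 nested layout)
set_option linter.dupNamespace false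

noncomputable section

open Set Function Filter Topology MeasureTheory Metric
open scoped NNReal ENNReal ContDiff

namespace Summit.NavierStokesRegularity.NavierStokesRegularity.Theorems.ScenarioCensus.RateGate

open Literature.Analysis Literature.Analysis.FluidPDE
open Summit.NavierStokesRegularity.NavierStokesRegularity.Theorems.ScenarioCensus
open Summit.NavierStokesRegularity.NavierStokesRegularity.Theorems.ScenarioCensus.ModulationGate

/-! ## §2 (of the line) Chae's deviation in the remainder vocabulary -/

/-- Chae's deviation is `ℓ(t)^{(p−3)/p} ‖r(t)‖_{L^p}` (definitional). -/
theorem chaeTypeIIDeviation_eq_remainder (T γ : ℝ) (p : ℝ≥0)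
    (v : ℝ → EuclideanSpace ℝ (Fin 3) → EuclideanSpace ℝ (Fin 3))
    (V : EuclideanSpace ℝ (Fin 3) → EuclideanSpace ℝ (Fin 3)) (t : ℝ) :
    chaeTypeIIDeviation T γ p v V t =
      ENNReal.ofReal ((T - t) ^ (((p : ℝ) - 3) * γ / (2 * (p : ℝ)))) *
        eLpNorm (typeIIRemainder T γ v V t) (p : ℝ≥0∞) volume :=
  rfl

/-! ## §3 G1 (power-law dissipation gate) and the wild residual — `RateGate` (G2) is the tree's `ModulationGate.RateGate` -/

/-- **G1 — the DISSIPATION GATE** (obligation Prop; **PROVED**: `dissipationGate_holds'`, §4c, rev 4).  Classical Leray–Hopf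
solution on `[0,T)`, ANY `p ≥ 2`, FAST Type-II rate `γ ≥ 2` (so `∫^T ℓ(t)⁻¹ dt = ∞`), `L^p` profile
with Chae's convergence.  Then `V̄ = 0` a.e.  Proof route (rev 2): `‖∇v(t)‖₂² = ℓ(t)⁻¹‖∇W(t)‖₂²` for
the zoom `W(t) → V̄` in `L^p`; the energy inequality makes `‖∇W(tₙ)‖₂ → 0` along some `tₙ ↑ T`; hence
`V̄` has weak gradient `0`, is a.e. constant, and is in `L^p`.  Why it might fail: only via typing —
needs the weak gradient of the LH structure to be `fderiv ℝ (v t)` for a.e. `t` (classical on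
`[0,T)`: `hasWeakGradient_fderiv_of_contDiff` + `HasWeakFDerivOn.unique_holds`, as in
`row_F4bp_of_steady`). -/
def DissipationGate : Prop :=
  ∀ (T : ℝ), 0 < T → ∀ (p : ℝ≥0), 2 ≤ p →
    ∀ (v : ℝ → EuclideanSpace ℝ (Fin 3) → EuclideanSpace ℝ (Fin 3))
      (π : ℝ → EuclideanSpace ℝ (Fin 3) → ℝ),
    IsClassicalNSSolutionOn (Ico 0 T) 1 0 v π → IsLerayHopfOn T 1 0 (v 0) v →
    ∀ (γ : ℝ), 2 ≤ γ → ∀ (V : EuclideanSpace ℝ (Fin 3) → EuclideanSpace ℝ (Fin 3)),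
    MemLp V (p : ℝ≥0∞) volume → Tendsto (chaeTypeIIDeviation T γ p v V) (𝓝[<] T) (𝓝 0) →
    V =ᵐ[volume] 0

/-- **The WILD residual — the weakest unknown consequence of `Row_F4bpLH`, typed.**  The sub-cell
of `Row_F4bpLH` with SLOW rate `1 < γ < 2` and UNTAMED remainder
`liminf_{t↑T} ℓ(t)^{3/(2p)}‖v(t) − v_ss(t)‖_{L^p} ≠ 0` (the remainder carries `L^p` norm
`≳ λ^{3/(2p)} → ∞` at every late time while staying `o(λ^{1−3/p})`), Chae's `V̄ ∈ Ḣ¹` kept.  OPEN.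
Implied by the steady wall `∀ q > 9/2, Row_F4bpSteady q` (`row_F4bpLHWild_of_steady`) and by
`Row_F4bpLH` (`row_F4bpLHWild_of_row_F4bpLH`); conversely it closes `Row_F4bpLH` given the two gates
(`row_F4bpLH_of_gates`).  The instrument row that would refute it: a Type-II blow-up in the
energy class, rate `1 < γ < 2`, whose remainder has `λ^{3/(2p)} ≲ ‖r(t)‖_{L^p} ≪ λ^{1−3/p}` (note
`‖r(t)‖_{L^p} = λ^{1−3/p} δ(t)`, so Chae's `δ → 0` is the upper edge); the window is non-empty
exactly when `p > 9/2`, and energetically admissible at intermediate scales `ℓ ≪ L ≲ ℓ^{1/(p−2)}`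
(card §Why-genuine).  No such construction is known (census D9/F4b′). -/
@[conjecture] def Row_F4bpLHWild : Prop :=
  ∀ (T : ℝ), 0 < T → ∀ (p : ℝ≥0), (9 / 2 : ℝ≥0∞) < (p : ℝ≥0∞) →
    ∀ (v : ℝ → EuclideanSpace ℝ (Fin 3) → EuclideanSpace ℝ (Fin 3))
      (π : ℝ → EuclideanSpace ℝ (Fin 3) → ℝ),
    IsClassicalNSSolutionOn (Ico 0 T) 1 0 v π → IsLerayHopfOn T 1 0 (v 0) v →
    ∀ (γ : ℝ), 1 < γ → γ < 2 → ∀ (V : EuclideanSpace ℝ (Fin 3) → EuclideanSpace ℝ (Fin 3)),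
    MemLp V (p : ℝ≥0∞) volume → Tendsto (chaeTypeIIDeviation T γ p v V) (𝓝[<] T) (𝓝 0) →
    liminf (rateGateQuantity T γ p v V) (𝓝[<] T) ≠ 0 →
    eWeakGradL2Sq V < ⊤ → V =ᵐ[volume] 0

/-! ## §4 Kernel (sorry-free): the row in the LH frame ⟺ the wild residual, given the gates -/

/-- `9/2 < p` gives `2 ≤ p`. -/
theorem two_le_of_nineHalves_lt {p : ℝ≥0} (hp : (9 / 2 : ℝ≥0∞) < (p : ℝ≥0∞)) : 2 ≤ p := by
  have h3 : (3 : ℝ≥0) < p := by exact_mod_cast three_lt_of_nineHalves_lt hp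
  exact le_trans (by norm_num) h3.le

/-- **KERNEL.** The two gates and the wild residual close row F4b′ in the Leray–Hopf frame:
case split on the rate (`γ ≥ 2`: G1) and, for `1 < γ < 2`, on `liminf` of the rate-gate quantity
(`= 0`: G2; `≠ 0`: the residual). -/
theorem row_F4bpLH_of_gates (hG2 : RateGate) (hG1 : DissipationGate) (hW : Row_F4bpLHWild) :
    Row_F4bpLH := by
  intro T hT p hp v π hv hLH γ hγ V hV hconv hH1
  rcases le_or_gt 2 γ with hγ2 | hγ2
  · exact hG1 T hT p (two_le_of_nineHalves_lt hp) v π hv hLH γ hγ2 V hV hconv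
  · rcases eq_or_ne (liminf (rateGateQuantity T γ p v V) (𝓝[<] T)) 0 with h0 | h0
    · exact hG2 T hT p (three_lt_of_nineHalves_lt hp) v π hv hLH γ hγ V hV hconv h0
    · exact hW T hT p hp v π hv hLH γ hγ hγ2 V hV hconv h0 hH1

/-- The residual is a sub-cell of the row (wuc direction). -/
theorem row_F4bpLHWild_of_row_F4bpLH (h : Row_F4bpLH) : Row_F4bpLHWild :=
  fun T hT p hp v π hv hLH γ hγ _ V hV hconv _ hH1 => h T hT p hp v π hv hLH γ hγ V hV hconv hH1

/-- **Row F4b′ (LH frame) ⟺ its wild residual**, given the two gates. -/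
theorem row_F4bpLH_iff_wild (hG2 : RateGate) (hG1 : DissipationGate) :
    Row_F4bpLH ↔ Row_F4bpLHWild :=
  ⟨row_F4bpLHWild_of_row_F4bpLH, row_F4bpLH_of_gates hG2 hG1⟩

/-- **The LH-frame row follows from the steady wall** `∀ q > 9/2, Row_F4bpSteady q` — the tree's
bridge `row_F4bp_of_steady` verbatim (its Kato binder is unused there), with the classical solution
restricted from `[0,T)` to `(0,T)`. [cite: Chae2010, proof of Thm 1.4 (arXiv:0711.1113 §3)] -/
theorem row_F4bpLH_of_steady (hS : ∀ q : ℝ≥0, (9 / 2 : ℝ≥0∞) < (q : ℝ≥0∞) → Row_F4bpSteady q) :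
    Row_F4bpLH := by
  intro T hT p hp v π hsol _hLH γ hγ V hV hconv hH1
  have hv : IsClassicalNSSolutionOn (Ioo 0 T) 1 0 v π :=
    hsol.mono Ioo_subset_Ico_self (uniqueDiffOn_Ioo 0 T)
  have hp3e : (3 : ℝ≥0∞) < (p : ℝ≥0∞) := three_lt_of_nineHalves_lt hp
  have hp3 : (3 : ℝ≥0) < p := by exact_mod_cast hp3e
  have hp1 : (1 : ℝ≥0) ≤ p := le_trans (by norm_num) hp3.le
  obtain ⟨U, P, hUP, hVU⟩ := typeII_profile_ae_eq_steadyClassicalNS hT hv hγ hp3 hV hconv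
  have hprof : IsLerayProfile 1 0 U P := hUP.isLerayProfile_zero
  have hU1 : ContDiff ℝ 1 U := hUP.smooth_velocity.of_le (by norm_cast)
  have hUp : MemLp U (p : ℝ≥0∞) volume := hV.ae_eq hVU
  obtain ⟨G, hG⟩ := iInf_lt_iff.1 hH1
  obtain ⟨hWG, hGlt⟩ := iInf_lt_iff.1 hG
  have hWGU : HasWeakGradient U G := hWG.congr_ae hVU.symm
  have hDU : HasWeakGradient U (fderiv ℝ U) := hasWeakGradient_fderiv_of_contDiff hU1
  have haeG : fderiv ℝ U =ᵐ[volume] G := by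
    have := FunctionSpaces.HasWeakFDerivOn.unique_holds hDU hWGU
    simpa [Measure.restrict_univ] using this
  have hD : (∫⁻ x, ENNReal.ofReal (frobeniusNormSq (fderiv ℝ U x))) < ⊤ := by
    have e : (∫⁻ x, ENNReal.ofReal (frobeniusNormSq (fderiv ℝ U x))) =
        ∫⁻ x, ENNReal.ofReal (frobeniusNormSq (G x)) := by
      refine lintegral_congr_ae ?_
      filter_upwards [haeG] with x hx
      rw [hx]
    rw [e]; exact hGlt
  have hU0 : U = 0 := hS p hp hp1 U P hprof hUP.smooth_velocity hUP.smooth_pressure hD hUp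
  rw [hU0] at hVU
  exact hVU

/-- **The wild residual is weaker than the steady wall** (S1 ∩ Ḣ¹ ∩ L^q, `q > 9/2`). -/
theorem row_F4bpLHWild_of_steady
    (hS : ∀ q : ℝ≥0, (9 / 2 : ℝ≥0∞) < (q : ℝ≥0∞) → Row_F4bpSteady q) : Row_F4bpLHWild :=
  row_F4bpLHWild_of_row_F4bpLH (row_F4bpLH_of_steady hS)

/-! ## §4b G2 is a theorem (the CORE is the tree's `ModulationGate.steadyZoomDistance_holds`) -/

/-- `λ(t) = (T−t)^{−γ/2} → ∞` as `t ↑ T` (`γ > 0`) (the first field of LINE 16's `isStationaryModulation_chae`). -/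
theorem chaeModulation_tendsto_atTop {T γ : ℝ} (hγ : 0 < γ) :
    Tendsto (chaeModulation T γ) (𝓝[<] T) atTop := by
  have h0 : Tendsto (fun t : ℝ => (T - t) ^ (γ / 2)) (𝓝[<] T) (𝓝[>] 0) := by
    refine tendsto_nhdsWithin_iff.2 ⟨tendsto_rpow_sub_nhdsLT T (by positivity), ?_⟩
    exact eventually_nhdsWithin_of_forall fun t (ht : t < T) =>
      Real.rpow_pos_of_pos (sub_pos.2 ht) _
  exact tendsto_inv_nhdsGT_zero.comp h0

-- `rateGate_holds : RateGate` (LINE 15 §4b) is the tree's `ModulationGate.rateGate'` BY NAME (an alias theorem of an already-landed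
-- declaration is refused by the gate lint `dedup.landed`).

/-! ## §4c G1 is a theorem — DERIVED here from LINE 16's modulated gate (tree `ModulationGate.modulatedDissipationGate_holds'`) -/

/-- **Tree-only helper of the port.**  For `γ ≥ 2` the power-law modulation speed `λ = (T−t)^{−γ/2}` is NOT
integrable at `T`: `∫_{(T−ε,T)} λ = ∞` (as a lower integral; compare with `(T−t)⁻¹` where `T − t ≤ 1`, then
`ModulationGate.DissipationProof.lintegral_inv_sub_eq_top`). -/
theorem lintegral_chaeModulation_eq_top (T : ℝ) {γ : ℝ} (hγ2 : 2 ≤ γ) {ε : ℝ} (hε : 0 < ε) :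
    ∫⁻ t in Ioo (T - ε) T, ENNReal.ofReal (chaeModulation T γ t) = ⊤ := by
  set ε' : ℝ := min ε 1 with hε'
  have hε'pos : 0 < ε' := lt_min hε one_pos
  have hsub : Ioo (T - ε') T ⊆ Ioo (T - ε) T :=
    Ioo_subset_Ioo (by linarith [min_le_left ε 1]) le_rfl
  have hle : ∫⁻ t in Ioo (T - ε') T, ENNReal.ofReal ((T - t)⁻¹) ≤
      ∫⁻ t in Ioo (T - ε') T, ENNReal.ofReal (chaeModulation T γ t) := by
    refine setLIntegral_mono' measurableSet_Ioo fun t ht => ENNReal.ofReal_le_ofReal ?_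
    have hd : 0 < T - t := sub_pos.2 ht.2
    have hd1 : T - t ≤ 1 := by linarith [ht.1, min_le_right ε 1]
    unfold chaeModulation
    rw [← Real.rpow_neg_one, ← Real.rpow_neg hd.le]
    exact Real.rpow_le_rpow_of_exponent_ge hd hd1 (by linarith)
  have htop := DissipationProof.lintegral_inv_sub_eq_top T hε'pos
  refine eq_top_iff.2 ?_
  calc (⊤ : ℝ≥0∞) = ∫⁻ t in Ioo (T - ε') T, ENNReal.ofReal ((T - t)⁻¹) := htop.symm
    _ ≤ ∫⁻ t in Ioo (T - ε') T, ENNReal.ofReal (chaeModulation T γ t) := hle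
    _ ≤ ∫⁻ t in Ioo (T - ε) T, ENNReal.ofReal (chaeModulation T γ t) := lintegral_mono_set hsub

/-- **G1 `DissipationGate` — PROVED** (LINE 15 rev 4 §4c `dissipationGate_holds'`; here DERIVED from LINE 16's modulated
gate: the power law `λ = (T−t)^{−γ/2}`, `γ ≥ 2 > 1`, is a stationary modulation (`isStationaryModulation_chae`) with
non-integrable speed (`lintegral_chaeModulation_eq_top`), and its modulated deviation is Chae's (`modulatedDeviation_chae`)). -/
theorem dissipationGate_holds' : DissipationGate := by
  intro T hT p hp2 v π hv hLH γ hγ2 V hV hconv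
  have hγ1 : 1 < γ := lt_of_lt_of_le one_lt_two hγ2
  have hp0 : p ≠ 0 := (lt_of_lt_of_le two_pos hp2).ne'
  have hdev : Tendsto (modulatedDeviation (chaeModulation T γ) p v V) (𝓝[<] T) (𝓝 0) := by
    refine hconv.congr' ?_
    exact eventually_nhdsWithin_of_forall fun t (ht : t < T) =>
      (modulatedDeviation_chae hp0 v V ht).symm
  exact modulatedDissipationGate_holds' T hT p hp2 v π hv hLH (chaeModulation T γ)
    (isStationaryModulation_chae hγ1) (fun ε hε _ => lintegral_chaeModulation_eq_top T hγ2 hε) V hV hdev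

/-! ## §5 NO STUBS LEFT: the theorem of the line, UNCONDITIONAL -/

/-- **THEOREM OF THE LINE (rev 4: UNCONDITIONAL, sorry-free): F4b′ in the LH frame ⟺ the wild residual.** -/
theorem row_F4bpLH_iff_wild' : Row_F4bpLH ↔ Row_F4bpLHWild :=
  row_F4bpLH_iff_wild rateGate' dissipationGate_holds'

/-! ## §6 The rung by name (`ModulationGate.Row_F4bSharp`) and its corollaries -/

-- `row_F4bSharp_holds : Row_F4bSharp` and `row_F4b_holds' : Row_F4b` (LINE 15 §6) are the tree's `ModulationGate.row_F4bSharp_holds'`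
-- / `ModulationGate.row_F4b_holds''` BY NAME (alias theorems of already-landed declarations are refused by the gate lint `dedup.landed`).

/-- The census row F4b (tree decl `Row_F4b`, proved there WITH `Ḣ¹` as `row_F4b_excluded`) is a
weakening of the rung. -/
theorem row_F4b_of_sharp (h : Row_F4bSharp) : Row_F4b :=
  fun T hT p hp3 hp92 v π hv _ γ hγ V hV hconv _ => h T hT p hp3 hp92 v π hv γ hγ V hV hconv

/-- **The rate gate below the threshold is a theorem**: for `3 < p ≤ 9/2` the conclusion of
`RateGate` holds with the rate hypothesis (and the energy class) IGNORED — so the content of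
`RateGate` (proved in general in §4b) beyond the rung is exactly `p > 9/2`, where `β_p = 1 − 9/(2p) > 0`. -/
theorem rateGate_of_le_nineHalves
    ⦃T : ℝ⦄ (hT : 0 < T) ⦃p : ℝ≥0⦄ (hp3 : 3 < p) (hp92 : (p : ℝ≥0∞) ≤ 9 / 2)
    ⦃v : ℝ → EuclideanSpace ℝ (Fin 3) → EuclideanSpace ℝ (Fin 3)⦄
    ⦃π : ℝ → EuclideanSpace ℝ (Fin 3) → ℝ⦄
    (hv : IsClassicalNSSolutionOn (Ico 0 T) 1 0 v π)
    ⦃γ : ℝ⦄ (hγ : 1 < γ) ⦃V : EuclideanSpace ℝ (Fin 3) → EuclideanSpace ℝ (Fin 3)⦄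
    (hV : MemLp V (p : ℝ≥0∞) volume)
    (hconv : Tendsto (chaeTypeIIDeviation T γ p v V) (𝓝[<] T) (𝓝 0)) : V =ᵐ[volume] 0 :=
  row_F4bSharp_holds' T hT p hp3 hp92 v π (hv.mono Ioo_subset_Ico_self (uniqueDiffOn_Ioo 0 T))
    γ hγ V hV hconv

end Summit.NavierStokesRegularity.NavierStokesRegularity.Theorems.ScenarioCensus.RateGate

namespace Summit.NavierStokesRegularity.NavierStokesRegularity.Theorems.ScenarioCensus

/-! ## Census KEYS (ns `…Theorems.ScenarioCensus`): row F4b′ in the LH frame; OPEN — nothing asserted -/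

/-- **Row F4b′, forward = Leray–Hopf frame** (census row F4b′ «Type-II asymptotically self-similar blow-up with
`Ḣ¹ ∩ L^p` profile, `p > 9/2`», LH twin of the tree's Kato-frame key `Row_F4bp`): `:= ModulationGate.Row_F4bpLH`
(definitional alias).  By the THEOREM `RateGate.row_F4bpLH_iff_wild'` it is EQUIVALENT to its wild residual
`RateGate.Row_F4bpLHWild` (`1 < γ < 2`, untamed remainder, `V̄ ∈ Ḣ¹`); the fast cell `γ ≥ 2` (`RateGate.dissipationGate_holds'`)
and the tame cell (`ModulationGate.rateGate'`) are THEOREMS.  OPEN — nothing asserted.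
[cite: Chae2010, Thm 1.4 (= arXiv:0711.1113 Thm 3.1), case p > 9/2, finite-energy data] -/
@[conjecture] def Row_F4bpLH : Prop := ModulationGate.Row_F4bpLH

/-- The key is the lines' row, definitionally. -/
theorem row_F4bpLH_iff : Row_F4bpLH ↔ ModulationGate.Row_F4bpLH := Iff.rfl

/-- **Census reading of row F4b′ (LH frame) after LINE 15**: the key is equivalent to the WILD residual (unconditional). -/
theorem row_F4bpLH_iff_row_F4bpLHWild : Row_F4bpLH ↔ RateGate.Row_F4bpLHWild := RateGate.row_F4bpLH_iff_wild'

/-- **F4b′ (LH frame) is the power-law member of D9 (LH frame)**, at the level of the census keys. -/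
theorem row_F4bpLH_of_row_D9LH (h : Row_D9LH) : Row_F4bpLH := ModulationGate.row_F4bpLH_of_row_D9LH h

end Summit.NavierStokesRegularity.NavierStokesRegularity.Theorems.ScenarioCensus

end

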